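import Summits.Ventures.HodgeRepro2.T5HeckeInducedIrreducible
import Summits.Ventures.HodgeRepro2.T5HeckeInvariantsDetermine

/-!
# `π` is recovered from `π^K`: `π ≅ (π^K ⊗_{H(G, K)} k[G/K]) / X_max`

For an irreducible `K`-finite representation `π` with `π^K ≠ 0` (char 0, every double coset
`KgK/K` finite), the irreducible quotient `quotRep` of `π^K ⊗_{H(G, K)} k[G/K]` built in
`T5HeckeInducedIrreducible` is isomorphic to `π` (`nonempty_equiv_quotRep`): the inverse of the
bijection «irreducible `π` with `π^K ≠ 0` ↔ simple `H(G, K)`-modules» is the functor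
`M ↦ (M ⊗_{H(G, K)} k[G/K]) / X_max`.  Proof: `quotRep^K ≅ π^K` as Hecke modules
(`T5HeckeInducedIrreducible`), and an irreducible representation is determined by its
`K`-invariants (`T5HeckeInvariantsDetermine`).
-/

namespace Summit.Ventures.HodgeRepro2.T5HeckeInducedRecover

open T5HeckePermutationModule T5HeckeSimpleInvariants T5HeckeInducedIrreducible
  T5HeckeInvariantsDetermine LevelPositivity

variable {G : Type*} [Group G] {k : Type*} [Field k] {V : Type*} [AddCommGroup V] [Module k V]
  (ρ : Representation k G V) {K : Subgroup G}

/-- The Hecke module structure of `π^K` (`T5HeckePermutationModule.heckeModule`), as a local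
instance. -/
noncomputable local instance : Module (heckeAlgebra k K)ᵐᵒᵖ (invariants ρ K) := heckeModule ρ

/-- `op T • v = T • v` on `π^K`. -/
theorem op_smul_eq_heckeSMul (T : heckeAlgebra k K) (v : invariants ρ K) :
    MulOpposite.op T • v = heckeSMul ρ T v := by
  show heckeAction ρ (MulOpposite.op T) v = _
  rw [heckeAction_apply]
  rfl

/-- The Hecke module structure of `π^K` is compatible with the `k`-structure. -/
instance isScalarTower_heckeModule : IsScalarTower k (heckeAlgebra k K)ᵐᵒᵖ (invariants ρ K) :=
  ⟨fun c a v => by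
    induction a using MulOpposite.rec' with
    | h T =>
      rw [← MulOpposite.op_smul, op_smul_eq_heckeSMul, op_smul_eq_heckeSMul, heckeSMul_smul_left]⟩

variable (hfin : ∀ g : G, Finite (MulAction.orbit K (g : G ⧸ K))) [CharZero k]

/-- `π IS RECOVERED FROM π^K`: for an irreducible `K`-finite `π` with `π^K ≠ 0`, the irreducible
quotient of `π^K ⊗_{H(G, K)} k[G/K]` is isomorphic to `π`. -/
theorem nonempty_equiv_quotRep [ρ.IsIrreducible] (hK : T5LevelIdempotent.KFinite ρ K)
    (hne : invariants ρ K ≠ ⊥) :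
    Nonempty ((quotRep k K (invariants ρ K) hfin).Equiv ρ) := by
  haveI : IsSimpleOrder (Submodule (heckeAlgebra k K)ᵐᵒᵖ (invariants ρ K)) :=
    (isSimpleModule_heckeModule ρ hK hfin hne).toIsSimpleOrder
  obtain ⟨hirr, hKq, e, he⟩ := isIrreducible_and_kFinite_and_equiv k K (invariants ρ K) hfin
  haveI := hirr
  haveI : Nontrivial (invariants ρ K) := Submodule.nontrivial_iff_ne_bot.2 hne
  obtain ⟨m₀, hm₀⟩ := exists_ne (0 : invariants ρ K)
  have hφ : ∀ (T : heckeAlgebra k K) (m : invariants (quotRep k K (invariants ρ K) hfin) K),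
      e.symm.toLinearMap (heckeSMul (quotRep k K (invariants ρ K) hfin) T m) =
        heckeSMul ρ T (e.symm.toLinearMap m) := by
    intro T m
    show e.symm (heckeSMul (quotRep k K (invariants ρ K) hfin) T m) = heckeSMul ρ T (e.symm m)
    conv_lhs => rw [← e.apply_symm_apply m, he T, e.symm_apply_apply]
    rw [op_smul_eq_heckeSMul]
  refine nonempty_equiv_of_injective_heckeEquivariant (quotRep k K (invariants ρ K) hfin) ρ
    e.symm.toLinearMap hKq hK hfin e.symm.injective hφ (v₀ := e m₀) ?_
  intro h
  apply hm₀
  exact e.injective (h.trans (map_zero e).symm)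

end Summit.Ventures.HodgeRepro2.T5HeckeInducedRecover
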